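import Summits.CriticalPhenomena.SAWScalingLimit.Theorems.SAWCircleScreeningScreeningRecursionScreenLaw
import Summits.CriticalPhenomena.SAWScalingLimit.Theorems.SAWCircleScreeningScreeningRecursionLawReal
import HarnessLib

/-!
# Screening recursion for `SAWCircleScreening`, part XV: the screen kernel of the coupling step

Route `SAWCircleScreening` of `CriticalPhenomena/SAWScalingLimit`, support item
`ScreeningRecursion` (stmt-CriticalPhenomena-5468). The abstract coupling step (part IIb) consumes
the exact screen in the integrated form

  `∑ₓ p x · g(s x) · 1[Φ x ∈ A] = ∑ₓ p x · g(s x) · q_{s x}(A)`,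

where `s x ∈ Option (ℕ × Site 2 × Site 2)` is the canonical screen datum of the SAW `x` (none if
no grid circle of radius in `[2ρ, 3ρ]` is crossed exactly once) and `q_v(A)` is the law of `Φ`
under the critical SAW of `(Ω₀ ∖ K_s(v))_δ` from the exit vertex `y = v.2.2` — a kernel that
does NOT depend on the near data `K` nor on the start `a` (`screen_identity`). Ingredients:
`law_screen_event` (part XII), uniqueness of the screen datum (`screen_unique`, part XI), and the
regrouping identity of part XIII. Folklore.
-/

noncomputable section

open Set Metric MeasureTheory Finset
open scoped ENNReal
open Literature.Probability.LatticeModels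
open Literature.Probability.RandomPlanarGeometry
open Literature.Probability.RandomPlanarGeometry.SAW

namespace Summit.CriticalPhenomena.SAWScalingLimit.Theorems.ScreeningRecursion

variable {δ : ℝ} {c : ℂ}

section ScreenStep

local notation3 "ScrEv[" δ ", " c ", " ρ "](" j ", " x ", " y " ; " l ")" =>
  (2 * ρ + (j : ℝ) * δ ≤ 3 * ρ ∧
    (∃ k : ℕ, (∀ i : ℕ, (hi : i < List.length l) →
        (dist (meshPoint δ (l[i])) c < 2 * ρ + (j : ℝ) * δ ↔ i ≤ k)) ∧
      l[k]? = some x ∧ l[k + 1]? = some y) ∧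
    ∀ j' : ℕ, j' < j → ¬ ∃ k : ℕ, ∀ i : ℕ, (hi : i < List.length l) →
        (dist (meshPoint δ (l[i])) c < 2 * ρ + (j' : ℝ) * δ ↔ i ≤ k))

open scoped Classical in
/-- **The screen datum as a partial function.** `s(l) = some v` iff the canonical-screen event
of datum `v` holds for `l` (uniqueness of the datum). [folklore] -/
theorem screenOf_eq_some_iff {ρ : ℝ} (l : List (Site 2)) (v : ℕ × Site 2 × Site 2) :
    (if h : ∃ w : ℕ × Site 2 × Site 2, ScrEv[δ, c, ρ](w.1, w.2.1, w.2.2 ; l)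
      then some (Classical.choose h) else none) = some v ↔
      ScrEv[δ, c, ρ](v.1, v.2.1, v.2.2 ; l) := by
  constructor
  · intro h
    by_cases hex : ∃ w : ℕ × Site 2 × Site 2, ScrEv[δ, c, ρ](w.1, w.2.1, w.2.2 ; l)
    · rw [dif_pos hex] at h
      have hv : Classical.choose hex = v := Option.some.inj h
      rw [← hv]
      exact Classical.choose_spec hex
    · rw [dif_neg hex] at h
      exact absurd h (by simp)
  · intro hv
    have hex : ∃ w : ℕ × Site 2 × Site 2, ScrEv[δ, c, ρ](w.1, w.2.1, w.2.2 ; l) := ⟨v, hv⟩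
    rw [dif_pos hex]
    congr 1
    exact screen_unique (ρ := ρ) l (Classical.choose_spec hex) hv

/-- **The screen identity of the coupling step.** Bounded `Ω₀` flat at `c` up to `ρ₀ > 3ρ + δ`;
near data `K ⊆ B̄(c, ρ)`, `2δ ≤ ρ`; start `a` within `ρ`, target `b` at distance `≥ 3ρ + δ`
with `b ∈ (Ω₀ ∖ K)_δ` and `b ∈ (Ω₀ ∖ K_s(j))_δ` for all grid radii; `Φ` forgetting initial
segments inside `B(c, R⋆)`, `R⋆ ≥ 3ρ + δ`; `s` the screen datum (any partial function with
`s x = some v ↔ E_v`). Then for every weight `g` of the screen datum with `g none = 0` and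
every `A`:
`∑ₓ p x g(s x) 1[Φ x ∈ A] = ∑ₓ p x g(s x) q_{s x}(A)`. [folklore] -/
theorem screen_identity {Ω₀ K : Set ℂ} {u : ℂ} {ρ₀ ρ Rstar : ℝ} {a b : Site 2}
    (hΩ₀ : Bornology.IsBounded Ω₀)
    (hflat : Ω₀ ∩ ball c ρ₀ = {z | 0 < ((z - c) * u).im} ∩ ball c ρ₀)
    (hδ : 0 < δ) (hδρ : 2 * δ ≤ ρ) (hρρ₀ : 3 * ρ + δ < ρ₀) (hK : K ⊆ closedBall c ρ)
    (ha : dist (meshPoint δ a) c ≤ ρ) (hbfar : 3 * ρ + δ ≤ dist (meshPoint δ b) c)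
    (hb : b ∈ meshDomain (Ω₀ \ K) δ)
    (hbs : ∀ j : ℕ, 2 * ρ + j * δ ≤ 3 * ρ →
      b ∈ meshDomain (Ω₀ \ (ball c (2 * ρ + j * δ) \ {z | ∃ x' y' : Site 2, (zdGraph 2).Adj x' y' ∧
        2 * ρ + j * δ ≤ dist (meshPoint δ x') c ∧ 2 * ρ + j * δ ≤ dist (meshPoint δ y') c ∧
        z ∈ segment ℝ (meshPoint δ x') (meshPoint δ y')})) δ)
    {Z : Type*} (Φ : List (Site 2) → Z) (hRstar : 3 * ρ + δ ≤ Rstar)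
    (hΦ : ∀ pfx l : List (Site 2), (∀ w ∈ pfx, dist (meshPoint δ w) c < Rstar) →
      (∃ h : l ≠ [], dist (meshPoint δ (l.head h)) c < Rstar) → Φ (pfx ++ l) = Φ l)
    [Fintype (DomainSAW (Ω₀ \ K) δ a b)]
    (s : DomainSAW (Ω₀ \ K) δ a b → Option (ℕ × Site 2 × Site 2))
    (hsv : ∀ x v, s x = some v ↔ ScrEv[δ, c, ρ](v.1, v.2.1, v.2.2 ; x.walk.support))
    (g : Option (ℕ × Site 2 × Site 2) → ℝ) (hg : g none = 0)
    (A : Set Z) [DecidablePred (· ∈ A)] :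
    ∑ x : DomainSAW (Ω₀ \ K) δ a b, (law (Ω₀ \ K) δ a b {x}).toReal * g (s x) *
        (if Φ x.walk.support ∈ A then 1 else 0) =
      ∑ x : DomainSAW (Ω₀ \ K) δ a b, (law (Ω₀ \ K) δ a b {x}).toReal * g (s x) *
        (s x).elim 0 (fun v =>
          (law (Ω₀ \ (ball c (2 * ρ + v.1 * δ) \ {z | ∃ x' y' : Site 2, (zdGraph 2).Adj x' y' ∧
              2 * ρ + v.1 * δ ≤ dist (meshPoint δ x') c ∧ 2 * ρ + v.1 * δ ≤ dist (meshPoint δ y') c ∧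
              z ∈ segment ℝ (meshPoint δ x') (meshPoint δ y')})) δ v.2.2 b
            {β | Φ β.walk.support ∈ A}).toReal) := by
  classical
  set p : DomainSAW (Ω₀ \ K) δ a b → ℝ := fun x => (law (Ω₀ \ K) δ a b {x}).toReal with hp
  set q : ℕ × Site 2 × Site 2 → ℝ := fun v =>
    (law (Ω₀ \ (ball c (2 * ρ + v.1 * δ) \ {z | ∃ x' y' : Site 2, (zdGraph 2).Adj x' y' ∧
        2 * ρ + v.1 * δ ≤ dist (meshPoint δ x') c ∧ 2 * ρ + v.1 * δ ≤ dist (meshPoint δ y') c ∧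
        z ∈ segment ℝ (meshPoint δ x') (meshPoint δ y')})) δ v.2.2 b
      {β | Φ β.walk.support ∈ A}).toReal with hq
  change ∑ x, p x * g (s x) * (if Φ x.walk.support ∈ A then 1 else 0) =
    ∑ x, p x * g (s x) * (s x).elim 0 q
  -- regroup along the screen datum
  have e1 : ∑ x, p x * g (s x) * (if Φ x.walk.support ∈ A then (1:ℝ) else 0) =
      ∑ o ∈ univ.image s, g o * ∑ x ∈ univ.filter (fun x => s x = o),
        p x * (if Φ x.walk.support ∈ A then (1:ℝ) else 0) := by
    rw [← sum_mul_apply_eq_sum_image]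
    exact Finset.sum_congr rfl fun x _ => by ring
  have e2 : ∑ x, p x * g (s x) * (s x).elim 0 q =
      ∑ o ∈ univ.image s, g o * ∑ x ∈ univ.filter (fun x => s x = o), p x * (s x).elim 0 q := by
    rw [← sum_mul_apply_eq_sum_image]
    exact Finset.sum_congr rfl fun x _ => by ring
  rw [e1, e2]
  refine Finset.sum_congr rfl fun o ho => ?_
  rcases o with _ | v
  · rw [hg, zero_mul, zero_mul]
  congr 1
  have e3 : ∑ x ∈ univ.filter (fun x => s x = some v), p x * (s x).elim 0 q =
      q v * ∑ x ∈ univ.filter (fun x => s x = some v), p x := by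
    rw [Finset.mul_sum]
    refine Finset.sum_congr rfl fun x hx => ?_
    rw [(Finset.mem_filter.1 hx).2]; simp; ring
  rw [e3]
  have e4 : ∑ x ∈ univ.filter (fun x => s x = some v), p x * (if Φ x.walk.support ∈ A then (1:ℝ) else 0) =
      (law (Ω₀ \ K) δ a b ({x | s x = some v} ∩ {x | Φ x.walk.support ∈ A})).toReal := by
    rw [toReal_law_inter_eq_sum_filter s (some v) {x | Φ x.walk.support ∈ A}]
    exact Finset.sum_congr rfl fun x _ => by simp [hp]
  have e5 : ∑ x ∈ univ.filter (fun x => s x = some v), p x =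
      (law (Ω₀ \ K) δ a b {x | s x = some v}).toReal := by
    have := toReal_law_inter_eq_sum_filter s (some v) (univ : Set (DomainSAW (Ω₀ \ K) δ a b))
    rw [Set.inter_univ] at this
    rw [this]
    exact Finset.sum_congr rfl fun x _ => by simp [hp]
  rw [e4, e5]
  have hEv : {x : DomainSAW (Ω₀ \ K) δ a b | s x = some v} =
      {x | ScrEv[δ, c, ρ](v.1, v.2.1, v.2.2 ; x.walk.support)} := by
    ext x; exact hsv x v
  rw [hEv]
  -- `v` is a genuine datum (the event is nonempty), so its grid radius is `≤ 3ρ`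
  obtain ⟨x₁, -, hx₁⟩ := Finset.mem_image.1 ho
  have hj : 2 * ρ + (v.1 : ℝ) * δ ≤ 3 * ρ := ((hsv x₁ v).1 hx₁).1
  obtain ⟨j, x, y⟩ := v
  have key := law_screen_event (c := c) hΩ₀ hflat hδ hδρ hρρ₀ hK ha hbfar j x y hj rfl hb (hbs j hj)
    Φ hRstar hΦ A
  have hset : {γ : DomainSAW (Ω₀ \ K) δ a b | ScrEv[δ, c, ρ](j, x, y ; γ.walk.support) ∧ Φ γ.walk.support ∈ A} =
      {γ | ScrEv[δ, c, ρ](j, x, y ; γ.walk.support)} ∩ {γ | Φ γ.walk.support ∈ A} := by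
    ext γ; simp only [mem_setOf_eq, mem_inter_iff]
  rw [hset] at key
  rw [key, ENNReal.toReal_mul, mul_comm]

end ScreenStep

end Summit.CriticalPhenomena.SAWScalingLimit.Theorems.ScreeningRecursion

end
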